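import Summits.QuantumAdvantage.QuantumAdvantage.Theses.WhiteBoxWalk
import Summits.QuantumAdvantage.QuantumAdvantage.Theses.PromiseLift
import Literature.Computability.QuantumComplexity.PromiseBQPSubsetPromisePP
import Literature.Computability.Complexity.PromiseZPPProofs

/-!
# Ladder-down census for the crux `WbwPromiseLift` / `PlLift` (item stmt-QuantumAdvantage-0250)

Forward generator G4 `ladder-down` (unit fwd-ladder-QuantumAdvantage-52, seed g4t-QuantumAdvantage-WbwPromiseLift).
TOP (not filed): `PlLift : BQP ⊆ BPP → PromiseBQP ⊆ PromiseBPP'` (`= WbwPromiseLift` by `rfl`), which is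
`QuantumAdvantage ∨ (PromiseBQP ⊆ PromiseBPP')` (`Cruxes/PlLift/Disproof.lean: plLift_iff`).

The crux in its OWN language has five gradation parameters; each is typed below as a family with its
FLOOR proved (the highest rung that is a theorem of the tree) and its TOP identified with `PlLift`:

* `LiftOn 𝓕`   — admissible family of promise problems (promise complexity / size of the ungapped set /
                  planted families): floor `𝓕 = range ofLanguage` (total promise), top `𝓕 = univ`;
* `LiftFrom H`  — strength of the collapse hypothesis: floor `H = (PP ⊆ BPP)`, top `H = (BQP ⊆ BPP)`;
* `LiftOf 𝒬`   — source class: floor `𝒬 = promiseLift BQP`, top `𝒬 = PromiseBQP`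
                  (gap = route PromiseLift's `PlPromiseIsLift`, relativized-false);
* `LiftInto 𝒟` — target class: floor `𝒟 = promiseLift PP` (unconditional), top `𝒟 = PromiseBPP'`;
* `PlantedLift` — the route-local rung `WbwThesis → QuantumAdvantage` above the landed
                  `WbwCertifiedThesis → QuantumAdvantage` (Lines/certified_canonical_lift, p114046 ∘ p114444).

Every rung is a consequence of the summit (`liftOn_of_summit` etc.: on-path), and no rung above a floor
is claimed provable here.  See `LADDER-WbwPromiseLift.md` for the census, sources and ceiling.
-/

namespace Summit.QuantumAdvantage.QuantumAdvantage.Cruxes.PlLift.LadderDown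

open Literature.Computability.Complexity Literature.Computability.Cryptography
  Literature.Computability.QuantumComplexity

/-! ### Axis F — admissible family of promise problems -/

/-- `LiftOn 𝓕`: the promise lift restricted to the promise problems of the family `𝓕`. -/
def LiftOn (𝓕 : Set PromiseProblem) : Prop :=
  BQP ⊆ BPP → ∀ Q ∈ PromiseBQP, Q ∈ 𝓕 → Q ∈ PromiseBPP'

/-- Larger families are harder. -/
theorem liftOn_anti {𝓕 𝓕' : Set PromiseProblem} (h : 𝓕 ⊆ 𝓕') : LiftOn 𝓕' → LiftOn 𝓕 :=
  fun hL hsub Q hQ hF => hL hsub Q hQ (h hF)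

/-- TOP: the whole family is the crux `PlLift`. -/
theorem liftOn_univ_iff : LiftOn Set.univ ↔ Theses.PromiseLift.PlLift :=
  ⟨fun h hsub Q hQ => h hsub Q hQ trivial, fun h hsub Q hQ _ => h hsub hQ⟩

/-- TOP, WhiteBoxWalk's name for it (`WbwPromiseLift = PlLift` by `rfl`). -/
theorem liftOn_univ_iff_wbw : LiftOn Set.univ ↔ Theses.WhiteBoxWalk.WbwPromiseLift :=
  liftOn_univ_iff

/-- FLOOR family F₀: total promise problems (languages; no ungapped input). -/
def totalFamily : Set PromiseProblem :=
  Set.range PromiseProblem.ofLanguage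

/-- FLOOR (proved): on total promise problems the lift is "totality for free"
(`ofLanguage_mem_PromiseBQP_iff`, `ofLanguage_mem_PromiseBPP'_iff`). -/
theorem liftOn_total : LiftOn totalFamily := by
  rintro hsub Q hQ ⟨L, rfl⟩
  rw [ofLanguage_mem_PromiseBQP_iff] at hQ
  rw [ofLanguage_mem_PromiseBPP'_iff]
  exact hsub hQ

/-- RUNG family F_NP (axis θ1, promise complexity): the promise `yes ⊔ no` is an `NP` language. -/
def npPromiseFamily : Set PromiseProblem :=
  {Q | (Q.yes ⊔ Q.no) ∈ Nondeterministic.NP}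

/-- Candidate next rung R1: the lift for `PromiseBQP` problems whose promise is `NP`-certifiable. -/
def LiftOnNP : Prop :=
  LiftOn npPromiseFamily

/-- RUNG family F_un (axis θ4, thin promise): unary promise problems (inputs `1ⁿ`). -/
def unaryFamily : Set PromiseProblem :=
  {Q | ∀ x ∈ Q.yes ⊔ Q.no, ∀ b ∈ x, b = true}

/-- Candidate rung R1′: the lift for unary `PromiseBQP` problems (relativized-FALSE in the world of
`Literature.Barriers.QuantumAdvantage.PromiseLiftRelativization`: its separating problem fails at inputs `1ⁿ`). -/
def LiftOnUnary : Prop :=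
  LiftOn unaryFamily

/-- The top gives every rung of the axis. -/
theorem liftOn_of_plLift (𝓕 : Set PromiseProblem) : Theses.PromiseLift.PlLift → LiftOn 𝓕 :=
  fun h => liftOn_anti (Set.subset_univ 𝓕) (liftOn_univ_iff.2 h)

/-- ON-PATH: the summit gives every rung of the axis (vacuously: the hypothesis `BQP ⊆ BPP` fails). -/
theorem liftOn_of_summit (𝓕 : Set PromiseProblem) : _root_.QuantumAdvantage → LiftOn 𝓕 := by
  rintro ⟨L, hL, hnL⟩ hsub
  exact absurd (hsub hL) hnL

/-! ### Axis X — the route-local planted rung -/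

/-- Candidate rung R1″ (route-local, axis θ6): WhiteBoxWalk's planted witness `X = WbwThesis` already
gives the summit.  Floor below it (LANDED): `WbwCertifiedThesis → QuantumAdvantage`
(`Cruxes/PlLift/Lines/certified_canonical_lift.lean`, stubs `stub_certify` p114046, `stub_canonical_lift` p114444). -/
def PlantedLift : Prop :=
  Theses.WhiteBoxWalk.WbwThesis → _root_.QuantumAdvantage

/-- ON-PATH: the summit gives the planted rung. -/
theorem plantedLift_of_summit : _root_.QuantumAdvantage → PlantedLift :=
  fun h _ => h

/-- Inside WhiteBoxWalk (given `X`), the planted rung gives the crux — through the summit. -/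
theorem wbwPromiseLift_of_plantedLift (hR : PlantedLift) (hX : Theses.WhiteBoxWalk.WbwThesis) :
    Theses.WhiteBoxWalk.WbwPromiseLift :=
  liftOn_univ_iff_wbw.1 (liftOn_of_summit _ (hR hX))

/-! ### Axis H — strength of the collapse hypothesis -/

/-- `LiftFrom H`: the promise collapse from the hypothesis `H`. -/
def LiftFrom (H : Prop) : Prop :=
  H → PromiseBQP ⊆ PromiseBPP'

/-- TOP: `H = (BQP ⊆ BPP)` is the crux. -/
theorem liftFrom_bqp_iff : LiftFrom (BQP ⊆ BPP) ↔ Theses.PromiseLift.PlLift :=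
  Iff.rfl

/-- FLOOR (proved): from `PP ⊆ BPP` the promise collapse follows, because `PromiseBQP ⊆ promiseLift PP`
(Adleman–DeMarrais–Huang, tree theorem `PromiseBQP_subset_promiseLift_PP`) and `promiseLift` is monotone. -/
theorem liftFrom_PP : LiftFrom (Literature.Computability.Complexity.PP ⊆ BPP) :=
  fun h => PromiseBQP_subset_promiseLift_PP.trans
    ((promiseLift_mono h).trans PromiseBPP_subset_PromiseBPP'_holds)

/-- Weaker hypotheses are harder. -/
theorem liftFrom_anti {H H' : Prop} (h : H' → H) : LiftFrom H → LiftFrom H' :=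
  fun hL h' => hL (h h')

/-! ### Axis Q — source class -/

/-- `LiftOf 𝒬`: the lift for the source class `𝒬`. -/
def LiftOf (𝒬 : Set PromiseProblem) : Prop :=
  BQP ⊆ BPP → 𝒬 ⊆ PromiseBPP'

/-- TOP: `𝒬 = PromiseBQP` is the crux. -/
theorem liftOf_PromiseBQP_iff : LiftOf PromiseBQP ↔ Theses.PromiseLift.PlLift :=
  Iff.rfl

/-- FLOOR (proved): the SEPARABLE quantum promise problems `promiseLift BQP` lift (monotonicity). -/
theorem liftOf_promiseLift_BQP : LiftOf (promiseLift BQP) :=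
  fun h => (promiseLift_mono h).trans PromiseBPP_subset_PromiseBPP'_holds

/-- The gap floor → top on this axis is exactly route PromiseLift's crux `PlPromiseIsLift`
(`PromiseBQP ⊆ promiseLift BQP`; relativized-false: `not_PromiseBQPRel_subset_promiseLift`). -/
theorem liftOf_top_of_isLift (h : Theses.PromiseLift.PlPromiseIsLift) : LiftOf PromiseBQP :=
  fun hsub => h.trans (liftOf_promiseLift_BQP hsub)

/-! ### Axis D — target class -/

/-- `LiftInto 𝒟`: the lift into the target class `𝒟`. -/
def LiftInto (𝒟 : Set PromiseProblem) : Prop :=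
  BQP ⊆ BPP → PromiseBQP ⊆ 𝒟

/-- TOP: `𝒟 = PromiseBPP'` is the crux. -/
theorem liftInto_PromiseBPP'_iff : LiftInto PromiseBPP' ↔ Theses.PromiseLift.PlLift :=
  Iff.rfl

/-- FLOOR (proved, unconditional): `𝒟 = promiseLift PP`. -/
theorem liftInto_promiseLift_PP : LiftInto (promiseLift Literature.Computability.Complexity.PP) :=
  fun _ => PromiseBQP_subset_promiseLift_PP

/-- Larger targets are easier. -/
theorem liftInto_mono {𝒟 𝒟' : Set PromiseProblem} (h : 𝒟 ⊆ 𝒟') : LiftInto 𝒟 → LiftInto 𝒟' :=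
  fun hL hsub => (hL hsub).trans h

end Summit.QuantumAdvantage.QuantumAdvantage.Cruxes.PlLift.LadderDown
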